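import Mathlib
import HarnessLib
import Summits.AtomisticToContinuum.FouriersLaw.Theses.CoercivePulse
import Summits.AtomisticToContinuum.FouriersLaw.Theses.CurrentTiltQuench
import Summits.AtomisticToContinuum.FouriersLaw.Theses.NoHiddenChargesKubo
import Summits.AtomisticToContinuum.FouriersLaw.Theses.CageBudgetFekete
import Summits.AtomisticToContinuum.FouriersLaw.Theses.HoelderEscapeProfile
import Literature.MathematicalPhysics.KineticTheory.InfiniteChainSuperstableDynamics
import Literature.MathematicalPhysics.KineticTheory.InfiniteChainObservables
import Literature.MathematicalPhysics.KineticTheory.InfiniteChainGoodSetSymmetries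

/-!
# Birth skeleton (BC3) for crux `CoercivePulse.SymmetricSetup`
(item `stmt-AtomisticToContinuum-11036`; route `route-AtomisticToContinuum-CoercivePulse`, crux rank 9;
the SAME item is wanted verbatim by `CurrentTiltQuench` / `NoHiddenChargesKubo` (support) and
`CageBudgetFekete` / `HoelderEscapeProfile` (crux); sub-problem `FouriersLaw`;
registrar `planner-skel-stmt-AtomisticToContinuum-11036-0`, 2026-08-17)

Crux (FIXED, concluded BY NAME below): for `pinnedChain ω₂ lam β γ` (`ω₂, lam, β > 0`, any bath
constant `γ`) and every `T > 0` there are a DLR Gibbs state `μ_T` which is shift-invariant AND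
momentum-reversal invariant (`μ_T ∘ R⁻¹ = μ_T`, `(Rσ)_x = (q_x, -p_x)`) and an infinite-volume
dynamics `D` preserving `μ_T` whose flow commutes with the unit shift `μ_T`-a.e.

## Line `birth` — STATICS × UNIQUENESS × DYNAMICS, hinged on Buttà–Marchioro superstability

The symmetric set-up is the meeting point of three theorems of different nature, and the hinge
between them is BM's superstability estimate (2.3) (`HasSuperstabilityEstimate`):

* `stub_superstableGibbsState` (STATICS / existence): at every `T > 0` the chain has a DLR Gibbs
  state which is shift-invariant and obeys (2.3) — the two-sided stationary Markov chain of the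
  transfer operator `e^{-U/2T} e^{-V(q'-q)/T} e^{-U/2T}` (Hilbert–Schmidt since `U ≥ ω₂q²/2`).
  Sources: Georgii2011 Thm 10.25/§11.1; BenfattoEtAl1980 (superstable states); in tree it is
  `OscillatorChain.exists_isChainGibbsMeasure_shiftInvariant_superstable_pinnedChain`
  (`Literature/…/InfiniteChainGibbsExistenceShift.lean`, PROVED) — size S given the tree.
* `stub_shiftInvariantGibbsUnique` (UNIQUENESS in the translation-invariant class): two
  shift-invariant DLR states at the same `T` coincide (1-D unbounded-spin uniqueness,
  CassandroOlivieriPellegrinottiPresutti1978 §3 / Georgii2011 Thm 10.25). In tree: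
  `OscillatorChain.eq_of_isChainGibbsMeasure_of_isShiftInvariant_pinnedChain`
  (`…/InfiniteChainShiftInvariantUniqueness.lean`, PROVED) — size S given the tree.
  ROLE: it manufactures the momentum-reversal clause WITHOUT any dynamics: `μ ∘ R⁻¹` is again a
  shift-invariant DLR state at `T` (`IsChainGibbsMeasure.map_momentumReversalZ`,
  `IsShiftInvariant.map_momentumReversalZ`, tree), hence `= μ`.
* `stub_superstableDynamics` (DYNAMICS on the canonical carrier): ONE temperature-blind
  infinite-volume dynamics `D` of the chain with carrier BM's good set `𝒳₀ = bmGood` which preserves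
  EVERY DLR Gibbs state obeying (2.3) — Buttà–Marchioro 2016 Thm 2.1 (flow on `𝒳₀`, quartic `U`
  AND quartic `V` allowed in `d = 1`) + eq. (2.6) (`μ(𝒳₀ᶜ) = 0` for superstable `μ`) + the
  severed-flow invariance of Gibbs states (LLL1977 §4 (i)) passed to the limit. In tree:
  `OscillatorChain.exists_bmDynamics` (`…/InfiniteChainGibbsInvariance.lean`, PROVED; apply with
  `s₁ = s₂ = 2`, `pinnedChain_isEvenPolyOfDegree_U/_V`) — size S given the tree.
* COMPOSITION `SymmetricSetup_of` = `symmetricSetup_of_stubs stub₁ stub₂ stub₃`, where the seam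
  `symmetricSetup_of_stubs` is kernel-checked and sorry-free and does the two symmetry transfers:
  reversal invariance BY UNIQUENESS (above) and a.e. shift-covariance of the flow FROM THE CANONICAL
  CARRIER (`𝒳₀` is shift-stable because `Q` is a supremum over all centres; on a shift-stable
  carrier of full measure the `unique` field gives `φ_t ∘ τ = τ ∘ φ_t` —
  `InfiniteChainDynamics.flow_comp_chainShift_ae_of_carrier_eq_bmGood` + `chainShift_one`, tree).

STATUS FLAG for the priority owner: every stub is discharged by ONE named, LANDED tree theorem (the
three quoted above; all accepted 2026-08-16 under the sibling items `FourierGreenKubo.InfiniteVolumeSetup`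
stmt-0743 and `EmbeddedDrudeMourre.GreenKuboContinuation` stmt-12597), so the crux is PROVABLE NOW; a
sorry-free candidate proof (this file with the three stubs discharged, concluding all five route decls
of the item) is attached as evidence `SymmetricSetupProof.lean` on stmt-AtomisticToContinuum-11036 for a
prover to land under `Summits/AtomisticToContinuum/FouriersLaw/Theorems/`.

Hardest stub: none is hard any more; historically `stub_superstableDynamics` (invariance of the DLR
state under the INFINITE-volume quartic-coupling flow — LLL1977 Thm 1 fails (A4), BM/BCDM assume
invariant states) was the unprinted step named in the item's why-might-fail; it is the 1726-line
`InfiniteChainSuperstableDynamicsProofs.lean` + `InfiniteChainGibbsInvariance.lean` in tree.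
Why the cut is not a costume: `stub_superstableGibbsState` has no dynamics and no reversal clause;
`stub_shiftInvariantGibbsUnique` and `stub_superstableDynamics` are UNIVERSAL statements over states
(they assert the existence of no state) — none gives the crux alone, and the crux (one state, one
dynamics) gives neither of the two universal stubs back. BC3 probes `stub → SymmetricSetup`,
`stub → FouriersLaw` by `first | exact? | simpa | aesop` fail for all three stubs (planner folder
`bc/`, quoted in `Lines/birth.md`).
Disproof used: none on file (`ledger crux ls stmt-AtomisticToContinuum-11036`: no workfiles before
this one; no `Negative/` lemma; negatives index of the summit has no entry on this item, 2026-08-17).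
-/

noncomputable section

namespace Summit.AtomisticToContinuum.FouriersLaw.Cruxes.SymmetricSetup

namespace Birth

open MeasureTheory Filter Set
open Literature.MathematicalPhysics.KineticTheory.HeatConduction

/-! ## The three registered stubs -/

/-- **stub 1 — `stub_superstableGibbsState` (STATICS).** For `pinnedChain ω₂ lam β γ`
(`ω₂, lam, β > 0`, any `γ`) and every `T > 0` there is a DLR Gibbs state at `T` which is invariant
under the spatial shift and satisfies Buttà–Marchioro's superstability estimate (2.3).
Discharged in tree by `OscillatorChain.exists_isChainGibbsMeasure_shiftInvariant_superstable_pinnedChain γ hω hl.le hβ.le hT`.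
[cite: Georgii2011, Thm 10.25 and §11.1] -/
theorem stub_superstableGibbsState :
    ∀ ω₂ lam β γ : ℝ, 0 < ω₂ → 0 < lam → 0 < β → ∀ T : ℝ, 0 < T → ∃ μ : MeasureTheory.Measure Literature.MathematicalPhysics.KineticTheory.HeatConduction.ChainConfig, (Literature.MathematicalPhysics.KineticTheory.HeatConduction.pinnedChain ω₂ lam β γ).IsChainGibbsMeasure T μ ∧ Literature.MathematicalPhysics.KineticTheory.HeatConduction.IsShiftInvariant μ ∧ (Literature.MathematicalPhysics.KineticTheory.HeatConduction.pinnedChain ω₂ lam β γ).HasSuperstabilityEstimate μ := by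
  sorry

/-- **stub 2 — `stub_shiftInvariantGibbsUnique` (UNIQUENESS in the translation-invariant class).**
For `pinnedChain ω₂ lam β γ` (`ω₂, lam, β > 0`, any `γ`) and `T > 0`, any two shift-invariant DLR
Gibbs states at `T` coincide. Discharged in tree by
`OscillatorChain.eq_of_isChainGibbsMeasure_of_isShiftInvariant_pinnedChain γ hω hl.le hβ.le hT h₁ hS₁ h₂ hS₂`.
[cite: CassandroOlivieriPellegrinottiPresutti1978, §3] -/
theorem stub_shiftInvariantGibbsUnique :
    ∀ ω₂ lam β γ : ℝ, 0 < ω₂ → 0 < lam → 0 < β → ∀ T : ℝ, 0 < T → ∀ μ₁ μ₂ : MeasureTheory.Measure Literature.MathematicalPhysics.KineticTheory.HeatConduction.ChainConfig, (Literature.MathematicalPhysics.KineticTheory.HeatConduction.pinnedChain ω₂ lam β γ).IsChainGibbsMeasure T μ₁ → Literature.MathematicalPhysics.KineticTheory.HeatConduction.IsShiftInvariant μ₁ → (Literature.MathematicalPhysics.KineticTheory.HeatConduction.pinnedChain ω₂ lam β γ).IsChainGibbsMeasure T μ₂ → Literature.MathematicalPhysics.KineticTheory.HeatConduction.IsShiftInvariant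 μ₂ → μ₁ = μ₂ := by
  sorry

/-- **stub 3 — `stub_superstableDynamics` (DYNAMICS on the canonical carrier `𝒳₀`).** For
`pinnedChain ω₂ lam β γ` (`ω₂, lam, β > 0`, any `γ`) there is ONE infinite-volume dynamics `D` with
carrier Buttà–Marchioro's good set `bmGood` which preserves every DLR Gibbs state (at any
temperature) obeying the superstability estimate (2.3). Discharged in tree by
`OscillatorChain.exists_bmDynamics` (`s₁ = s₂ = 2`, `pinnedChain_isEvenPolyOfDegree_U β γ hω.le hl`,
`pinnedChain_isEvenPolyOfDegree_V ω₂ lam γ hβ`; keep the conjuncts `carrier` and `PreservesMeasure`).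
[cite: ButtaMarchioro2016, §2 Thm 2.1 and eq. (2.6)] -/
theorem stub_superstableDynamics :
    ∀ ω₂ lam β γ : ℝ, 0 < ω₂ → 0 < lam → 0 < β → ∃ D : Literature.MathematicalPhysics.KineticTheory.HeatConduction.InfiniteChainDynamics (Literature.MathematicalPhysics.KineticTheory.HeatConduction.pinnedChain ω₂ lam β γ), D.carrier = (Literature.MathematicalPhysics.KineticTheory.HeatConduction.pinnedChain ω₂ lam β γ).bmGood ∧ ∀ (T : ℝ) (μ : MeasureTheory.Measure Literature.MathematicalPhysics.KineticTheory.HeatConduction.ChainConfig), (Literature.MathematicalPhysics.KineticTheory.HeatConduction.pinnedChain ω₂ lam β γ).IsChainGibbsMeasure T μ → (Literature.MathematicalPhysics.KineticTheory.HeatConduction.pinnedChain ω₂ lam β γ).HasSuperstabilityEstimate μ → D.PreservesMeasure μ := by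
  sorry

/-! ## The composition (sorry-free) -/

/-- **The seam, sorry-free** (axioms `propext`, `Classical.choice`, `Quot.sound`):
`stub_superstableGibbsState`-statement → `stub_shiftInvariantGibbsUnique`-statement →
`stub_superstableDynamics`-statement → the statement of `CoercivePulse.SymmetricSetup` (conclusion =
the crux's definiens VERBATIM, so that `SymmetricSetup_of` below is this term at the crux's name).
Content: take the superstable shift-invariant state `μ` of stub 1; its image `μ ∘ R⁻¹` under momentum
reversal is again a shift-invariant DLR state at `T` (the specification is `R`-covariant, `R`
commutes with the shift), so stub 2 gives `μ ∘ R⁻¹ = μ`; the dynamics `D` of stub 3 preserves `μ`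
(superstability), in particular `μ(𝒳₀ᶜ) = 0`, and since `𝒳₀` is shift-stable (`U, V ≥ 0`) the
`unique` field of `D` gives `φ_t ∘ τ₁ = τ₁ ∘ φ_t` on `𝒳₀`, i.e. `μ`-a.e. [folklore] -/
theorem symmetricSetup_of_stubs
    (hS : ∀ ω₂ lam β γ : ℝ, 0 < ω₂ → 0 < lam → 0 < β → ∀ T : ℝ, 0 < T → ∃ μ : MeasureTheory.Measure Literature.MathematicalPhysics.KineticTheory.HeatConduction.ChainConfig, (Literature.MathematicalPhysics.KineticTheory.HeatConduction.pinnedChain ω₂ lam β γ).IsChainGibbsMeasure T μ ∧ Literature.MathematicalPhysics.KineticTheory.HeatConduction.IsShiftInvariant μ ∧ (Literature.MathematicalPhysics.KineticTheory.HeatConduction.pinnedChain ω₂ lam β γ).HasSuperstabilityEstimate μ)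
    (hU : ∀ ω₂ lam β γ : ℝ, 0 < ω₂ → 0 < lam → 0 < β → ∀ T : ℝ, 0 < T → ∀ μ₁ μ₂ : MeasureTheory.Measure Literature.MathematicalPhysics.KineticTheory.HeatConduction.ChainConfig, (Literature.MathematicalPhysics.KineticTheory.HeatConduction.pinnedChain ω₂ lam β γ).IsChainGibbsMeasure T μ₁ → Literature.MathematicalPhysics.KineticTheory.HeatConduction.IsShiftInvariant μ₁ → (Literature.MathematicalPhysics.KineticTheory.HeatConduction.pinnedChain ω₂ lam β γ).IsChainGibbsMeasure T μ₂ → Literature.MathematicalPhysics.KineticTheory.HeatConduction.IsShiftInvariant μ₂ → μ₁ = μ₂)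
    (hD : ∀ ω₂ lam β γ : ℝ, 0 < ω₂ → 0 < lam → 0 < β → ∃ D : Literature.MathematicalPhysics.KineticTheory.HeatConduction.InfiniteChainDynamics (Literature.MathematicalPhysics.KineticTheory.HeatConduction.pinnedChain ω₂ lam β γ), D.carrier = (Literature.MathematicalPhysics.KineticTheory.HeatConduction.pinnedChain ω₂ lam β γ).bmGood ∧ ∀ (T : ℝ) (μ : MeasureTheory.Measure Literature.MathematicalPhysics.KineticTheory.HeatConduction.ChainConfig), (Literature.MathematicalPhysics.KineticTheory.HeatConduction.pinnedChain ω₂ lam β γ).IsChainGibbsMeasure T μ → (Literature.MathematicalPhysics.KineticTheory.HeatConduction.pinnedChain ω₂ lam β γ).HasSuperstabilityEstimate μ → D.PreservesMeasure μ) :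
    ∀ ω₂ lam β γ : ℝ, 0 < ω₂ → 0 < lam → 0 < β → ∀ T : ℝ, 0 < T → ∃ μ : MeasureTheory.Measure Literature.MathematicalPhysics.KineticTheory.HeatConduction.ChainConfig, (Literature.MathematicalPhysics.KineticTheory.HeatConduction.pinnedChain ω₂ lam β γ).IsChainGibbsMeasure T μ ∧ Literature.MathematicalPhysics.KineticTheory.HeatConduction.IsShiftInvariant μ ∧ μ.map (fun σ : Literature.MathematicalPhysics.KineticTheory.HeatConduction.ChainConfig => fun x : ℤ => ((σ x).1, -(σ x).2)) = μ ∧ ∃ D : Literature.MathematicalPhysics.KineticTheory.HeatConduction.InfiniteChainDynamics (Literature.MathematicalPhysics.KineticTheory.HeatConduction.pinnedChain ω₂ lam β γ), D.PreservesMeasure μ ∧ ∀ t : ℝ, ∀ᵐ σ ∂μ, D.flow t (Literature.MathematicalPhysics.KineticTheory.HeatConduction.shift σ) = Literature.MathematicalPhysics.KineticTheory.HeatConduction.shift (D.flow t σ) := by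
  intro ω₂ lam β γ hω hl hβ T hT
  -- stub 1: the superstable shift-invariant DLR state
  obtain ⟨μ, hG, hSI, hSS⟩ := hS ω₂ lam β γ hω hl hβ T hT
  -- stub 3: the temperature-blind dynamics on `𝒳₀`, which preserves `μ`
  obtain ⟨D, hcar, hpres⟩ := hD ω₂ lam β γ hω hl hβ
  have hP : D.PreservesMeasure μ := hpres T μ hG hSS
  refine ⟨μ, hG, hSI, ?_, D, hP, fun t => ?_⟩
  · -- reversal invariance BY UNIQUENESS (stub 2): `μ ∘ R⁻¹` is a shift-invariant DLR state at `T`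
    have hR : μ.map (momentumReversalZ : Literature.MathematicalPhysics.KineticTheory.HeatConduction.ChainConfig → Literature.MathematicalPhysics.KineticTheory.HeatConduction.ChainConfig) = μ :=
      hU ω₂ lam β γ hω hl hβ T hT _ _ hG.map_momentumReversalZ hSI.map_momentumReversalZ hG hSI
    exact hR
  · -- a.e. shift-covariance FROM THE CANONICAL CARRIER `𝒳₀` (shift-stable, of full `μ`-measure)
    have hU0 : ∀ r : ℝ, 0 ≤ (Literature.MathematicalPhysics.KineticTheory.HeatConduction.pinnedChain ω₂ lam β γ).U r := by
      intro r
      show 0 ≤ ω₂ * r ^ 2 / 2 + lam * r ^ 4 / 4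
      positivity
    have hV0 : ∀ r : ℝ, 0 ≤ (Literature.MathematicalPhysics.KineticTheory.HeatConduction.pinnedChain ω₂ lam β γ).V r := by
      intro r
      show 0 ≤ r ^ 2 / 2 + β * r ^ 4 / 4
      positivity
    have h := D.flow_comp_chainShift_ae_of_carrier_eq_bmGood hcar hU0 hV0 hP.1 t 1
    rw [chainShift_one] at h
    exact h.mono fun σ hσ => hσ

/-- **Skeleton theorem — the crux `CoercivePulse.SymmetricSetup` BY NAME from the three registered
stubs** (the only theorem of this file concluding the crux; its `sorry`s are exactly those of
`stub_superstableGibbsState`, `stub_shiftInvariantGibbsUnique`, `stub_superstableDynamics`; the seam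
is the sorry-free `symmetricSetup_of_stubs`). -/
theorem SymmetricSetup_of :
    _root_.Summit.AtomisticToContinuum.FouriersLaw.Theses.CoercivePulse.SymmetricSetup :=
  symmetricSetup_of_stubs stub_superstableGibbsState stub_shiftInvariantGibbsUnique
    stub_superstableDynamics

/-! ## The four sibling route decls of the same item (byte-identical signatures; one shared statement
item stmt-AtomisticToContinuum-11036 wanted by five routes) — concluded BY NAME from the same stubs, so that
this one skeleton serves every route wanting the crux. -/

/-- `CurrentTiltQuench.SymmetricSetup` (support, rank 9) from the three stubs. -/
theorem currentTiltQuench_symmetricSetup_of :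
    _root_.Summit.AtomisticToContinuum.FouriersLaw.Theses.CurrentTiltQuench.SymmetricSetup :=
  symmetricSetup_of_stubs stub_superstableGibbsState stub_shiftInvariantGibbsUnique
    stub_superstableDynamics

/-- `NoHiddenChargesKubo.SymmetricSetup` (support, rank 9) from the three stubs. -/
theorem noHiddenChargesKubo_symmetricSetup_of :
    _root_.Summit.AtomisticToContinuum.FouriersLaw.Theses.NoHiddenChargesKubo.SymmetricSetup :=
  symmetricSetup_of_stubs stub_superstableGibbsState stub_shiftInvariantGibbsUnique
    stub_superstableDynamics

/-- `CageBudgetFekete.SymmetricSetup` (crux, rank 7) from the three stubs. -/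
theorem cageBudgetFekete_symmetricSetup_of :
    _root_.Summit.AtomisticToContinuum.FouriersLaw.Theses.CageBudgetFekete.SymmetricSetup :=
  symmetricSetup_of_stubs stub_superstableGibbsState stub_shiftInvariantGibbsUnique
    stub_superstableDynamics

/-- `HoelderEscapeProfile.SymmetricSetup` (crux, rank 8) from the three stubs. -/
theorem hoelderEscapeProfile_symmetricSetup_of :
    _root_.Summit.AtomisticToContinuum.FouriersLaw.Theses.HoelderEscapeProfile.SymmetricSetup :=
  symmetricSetup_of_stubs stub_superstableGibbsState stub_shiftInvariantGibbsUnique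
    stub_superstableDynamics

end Birth

end Summit.AtomisticToContinuum.FouriersLaw.Cruxes.SymmetricSetup

end
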